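import Literature.AlgebraicGeometry.Frobenioids.FiberProductsBaseTrivial
import Literature.AlgebraicGeometry.Frobenioids.FiberProductsMorphisms
import HarnessLib

/-!
# Frobenioids I, Proposition 1.6 (v), clauses «metrically trivial» and «base-trivial»: the
# directions `C′ ⇒ C`, and «metrically trivial» `C ⇒ C′` at `Aut`-ample objects

Mochizuki, *The geometry of Frobenioids I: the general theory*, Kyushu J. Math. **62** (2008)
293–400, §1, Proposition 1.6 (v), printed p. 316 (kurims text p. 28)
[cite: MochizukiFrdI2008, Prop. 1.6(v) p.28]:

> "(v) A object of `C′` is Frobenius-trivial (respectively, quasi-Frobenius-trivial;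
> sub-quasi-Frobenius-trivial; metrically trivial; base-trivial; perfect; group-like;
> unit-trivial; Frobenius-normalized; isotropic; Frobenius-isotropic) if and only if it projects
> to such an object of `C`."

Here `C → F_Φ` is a Frobenioid over `D`, `D′ → D` a functor and `C′ := C ×_D D′` with its functor
`C′ → F_{Φ′}` (`FiberProducts.lean`).  PROOF-ONLY companion (abc-iut-found, typer of Prop. 1.6; no
new definitions) completing the per-clause census of (v) for the two clauses whose direction
`C ⇒ C′` needs more than lifting:

* «base-trivial», direction `C′ ⇒ C` (`isBaseTrivial_fst_of_fiberProduct`, immediate: put the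
  candidate `B` over the SAME object `A′` of `D′`); with abc-iut-L1-t8's direction `C ⇒ C′`
  (`isBaseTrivial_fiberProduct_of_fst`, `FiberProductsBaseTrivial.lean`, via "base-trivial ⇒
  `Aut`-ample") the clause «base-trivial» of (v) is PROVED AS PRINTED, both directions
  (`isBaseTrivial_fiberProduct_iff`);
* «metrically trivial», direction `C′ ⇒ C` (`isMetricallyTrivial_fst_of_fiberProduct`,
  immediate: lift a co-angular pre-step of `C` with identity `D′`-component; Prop. 1.6 (iii)/(iv)
  transfer co-angularity and pre-steps);
* «metrically trivial», direction `C ⇒ C′`, is FALSE AS PRINTED (abc-iut finding F-t8g2-1: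
  `TwoLevel.not_prop16vMetricallyTrivialIf`, `MetricallyTrivialFiberProductCounterexample.lean`)
  and is proved here under the REPAIR (OURS) "`A` is moreover `Aut`-ample"
  (`isMetricallyTrivial_fiberProduct_of_fst_of_isAutAmple`): the isomorphism `Y_C ≅ A` given by
  metric triviality is corrected to the base prescribed by the compatibility square by an
  automorphism of `A` — the same device as for «base-trivial»; in particular at base-trivial `A`
  and for `C` of metrically trivial and `Aut`-ample type (the standing type hypotheses of
  Prop. 2.5), `isOfType_isMetricallyTrivial_fiberProduct`.

Nothing here bears on [IUTchIII] Cor. 3.12; no statement of the paper is strengthened, and the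
refuted direction is not asserted.
-/

namespace Literature.AlgebraicGeometry.Frobenioids

open CategoryTheory Opposite

universe w v v' v'' u u' u''

namespace PreFrobenioid

variable {D : Type u} [Category.{v} D] {D' : Type u'} [Category.{v'} D']
  {Φ : Dᵒᵖ ⥤ CommMonCat.{w}} {C : Type u''} [Category.{v''} C]
  {F : C ⥤ ElemFrobenioid Φ} {G : D' ⥤ D}

/-! ### «base-trivial» -/

/-- **Prop. 1.6 (v)**, base-trivial objects, direction `C′ ⇒ C`: if `X = (A, A′, α)` is
base-trivial in `C′` then `A` is base-trivial in `C` (an object `B` of `C` base-isomorphic to `A`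
via `e : B_D ≅ A_D` underlies the object `(B, A′, α ∘ e)` of `C′`, base-isomorphic to `X` by the
identity of `A′`; an isomorphism with `X` projects to `B ≅ A`).  No hypothesis on `C`, `D′ → D`.
[cite: MochizukiFrdI2008, Prop. 1.6(v) p.28] -/
theorem isBaseTrivial_fst_of_fiberProduct (X : FiberProduct F G)
    (hX : IsBaseTrivial (fiberProductFunctor F G) X) : IsBaseTrivial F X.fst := by
  rintro B ⟨e⟩
  let Y : FiberProduct F G := ⟨B, X.snd, e.symm ≪≫ X.e⟩
  obtain ⟨i⟩ := hX Y ⟨Iso.refl _⟩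
  exact ⟨(CFP.proj₁ (baseFunctor F) G).mapIso i⟩

/-- **Prop. 1.6 (v)**, clause «base-trivial», AS PRINTED ("if and only if"), for a Frobenioid
`C → F_Φ` and any functor `D′ → D`: `X = (A, A′, α)` is base-trivial in `C′` iff `A` is base-trivial
in `C` (`⇐`: abc-iut-L1-t8's `isBaseTrivial_fiberProduct_of_fst`).
[cite: MochizukiFrdI2008, Prop. 1.6(v) p.28] -/
theorem isBaseTrivial_fiberProduct_iff (hF : IsFrobenioid F) (X : FiberProduct F G) :
    IsBaseTrivial (fiberProductFunctor F G) X ↔ IsBaseTrivial F X.fst :=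
  ⟨isBaseTrivial_fst_of_fiberProduct X, isBaseTrivial_fiberProduct_of_fst hF X⟩

/-! ### «metrically trivial» -/

/-- **Prop. 1.6 (v)**, metrically trivial objects, direction `C′ ⇒ C`: if `X = (A, A′, α)` is
metrically trivial in `C′` then `A` is metrically trivial in `C` (a co-angular pre-step
`ψ : A → B` of `C` lifts to the arrow `(ψ, id) : X → (B, A′, α ∘ ψ_D⁻¹)` of `C′`, a co-angular
pre-step by Prop. 1.6 (iii), (iv); an isomorphism of its codomain with `X` projects to `B ≅ A`).
No hypothesis on `C`, `D′ → D`. [cite: MochizukiFrdI2008, Prop. 1.6(v) p.28] -/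
theorem isMetricallyTrivial_fst_of_fiberProduct (X : FiberProduct F G)
    (hX : IsMetricallyTrivial (fiberProductFunctor F G) X) : IsMetricallyTrivial F X.fst := by
  intro B ψ hco hpre
  haveI : IsIso (Base F ψ) := hpre.2
  let ψ' : X ⟶ FiberProduct.liftTgt X ψ hpre.2 := FiberProduct.liftTgtHom X ψ hpre.2
  have hbi : IsBaseIso (fiberProductFunctor F G) ψ' := by
    show IsIso (𝟙 X.snd)
    infer_instance
  obtain ⟨i⟩ := hX ψ' (isCoAngular_fiberProduct_of_fst ψ' hco)
    ((isPreStep_fiberProduct_iff ψ' hbi).mpr hpre)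
  exact ⟨(CFP.proj₁ (baseFunctor F) G).mapIso i⟩

/-- **Prop. 1.6 (v)**, metrically trivial objects, direction `C ⇒ C′`, REPAIRED (OURS): if `A` is
metrically trivial AND `Aut`-ample then `X = (A, A′, α)` is metrically trivial in `C′`.  (A
co-angular pre-step `(ψ, ψ′) : X → Y` of `C′` projects to a co-angular pre-step `ψ : A → Y_C` of `C`
[Prop. 1.6 (iii), (iv)], so metric triviality of `A` gives SOME `j₀ : Y_C ≅ A`; its base is
corrected to the one the compatibility square prescribes by an automorphism of `A`, available by
`Aut`-ampleness.)  The printed clause omits `Aut`-ampleness and fails without it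
(`TwoLevel.not_prop16vMetricallyTrivialIf`). [cite: MochizukiFrdI2008, Prop. 1.6(v) p.28] -/
theorem isMetricallyTrivial_fiberProduct_of_fst_of_isAutAmple (hF : IsFrobenioid F)
    (X : FiberProduct F G) (hmt : IsMetricallyTrivial F X.fst) (hamp : IsAutAmple F X.fst) :
    IsMetricallyTrivial (fiberProductFunctor F G) X := by
  intro Y ψ' hco hpre
  -- the projection `ψ : A → Y_C` is a co-angular pre-step of `C`
  have hco₁ : IsCoAngular F ψ'.fst := isCoAngular_fst_of_fiberProduct hF ψ' hco
  have hpre₁ : IsPreStep F ψ'.fst := (isPreStep_fiberProduct_iff ψ' hpre.2).mp hpre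
  haveI : IsIso ψ'.snd := hpre.2
  obtain ⟨j₀⟩ := hmt ψ'.fst hco₁ hpre₁
  -- `g′ : X_{D′} ≅ Y_{D′}`, the `D′`-component of `ψ′`
  let g' : X.snd ≅ Y.snd := asIso ψ'.snd
  -- the correction: an automorphism of `A` with prescribed base
  let σ : (baseFunctor F).obj X.fst ≅ (baseFunctor F).obj X.fst :=
    ((baseFunctor F).mapIso j₀).symm ≪≫ Y.iso ≪≫ (G.mapIso g').symm ≪≫ X.iso.symm
  obtain ⟨τ, hτ⟩ := hamp σ
  have hτ' : Base F τ.hom = σ.hom := congrArg Iso.hom hτ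
  refine ⟨CFP.isoMk (j₀ ≪≫ τ) g'.symm ?_⟩
  show Base F (j₀.hom ≫ τ.hom) ≫ X.iso.hom = Y.iso.hom ≫ G.map g'.inv
  rw [base_comp, hτ']
  show ((baseFunctor F).map j₀.hom ≫
      ((baseFunctor F).map j₀.inv ≫ Y.iso.hom ≫ G.map g'.inv ≫ X.iso.inv)) ≫ X.iso.hom = _
  simp only [Category.assoc, Iso.inv_hom_id, Category.comp_id]
  rw [← Functor.map_comp_assoc, Iso.hom_inv_id, CategoryTheory.Functor.map_id, Category.id_comp]

/-- **Prop. 1.6 (v)**, clause «metrically trivial», both directions at an `Aut`-ample `A` (OURS as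
to the hypothesis): `X = (A, A′, α)` is metrically trivial in `C′` iff `A` is metrically trivial in
`C`. [cite: MochizukiFrdI2008, Prop. 1.6(v) p.28] -/
theorem isMetricallyTrivial_fiberProduct_iff_of_isAutAmple (hF : IsFrobenioid F)
    (X : FiberProduct F G) (hamp : IsAutAmple F X.fst) :
    IsMetricallyTrivial (fiberProductFunctor F G) X ↔ IsMetricallyTrivial F X.fst :=
  ⟨isMetricallyTrivial_fst_of_fiberProduct X,
    fun h => isMetricallyTrivial_fiberProduct_of_fst_of_isAutAmple hF X h hamp⟩

/-- **Prop. 1.6 (v)**, «metrically trivial», direction `C ⇒ C′` at a base-trivial `A` (OURS as to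
the hypothesis; a base-trivial object of a Frobenioid is `Aut`-ample, abc-iut-L1-t8's
`isAutAmple_of_isBaseTrivial`). [cite: MochizukiFrdI2008, Prop. 1.6(v) p.28] -/
theorem isMetricallyTrivial_fiberProduct_of_fst_of_isBaseTrivial (hF : IsFrobenioid F)
    (X : FiberProduct F G) (hmt : IsMetricallyTrivial F X.fst) (hbt : IsBaseTrivial F X.fst) :
    IsMetricallyTrivial (fiberProductFunctor F G) X :=
  isMetricallyTrivial_fiberProduct_of_fst_of_isAutAmple hF X hmt (isAutAmple_of_isBaseTrivial hF hbt)

/-- **Prop. 1.6 (v)**, «metrically trivial» at the level of types (OURS as to the hypothesis): if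
`C` is of metrically trivial and `Aut`-ample type — the standing hypotheses of [FrdI] Prop. 2.5 —
then `C′ = C ×_D D′` is of metrically trivial type (and of `Aut`-ample type,
`isAutAmple_fiberProduct_of_fst`). [cite: MochizukiFrdI2008, Prop. 1.6(v) p.28] -/
theorem isOfType_isMetricallyTrivial_fiberProduct (hF : IsFrobenioid F)
    (hmt : IsOfType (IsMetricallyTrivial F)) (hamp : IsOfType (IsAutAmple F)) :
    IsOfType (IsMetricallyTrivial (fiberProductFunctor F G)) :=
  fun X => isMetricallyTrivial_fiberProduct_of_fst_of_isAutAmple hF X (hmt X.fst) (hamp X.fst)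

/-- The direction `C′ ⇒ C` at the level of types, objectwise: if `C′` is of metrically trivial type
then every object `A` of `C` underlying some `X = (A, A′, α) ∈ Ob(C′)` is metrically trivial.
[cite: MochizukiFrdI2008, Prop. 1.6(v) p.28] -/
theorem isMetricallyTrivial_of_isOfType_fiberProduct
    (h : IsOfType (IsMetricallyTrivial (fiberProductFunctor F G))) (X : FiberProduct F G) :
    IsMetricallyTrivial F X.fst :=
  isMetricallyTrivial_fst_of_fiberProduct X (h X)

end PreFrobenioid

end Literature.AlgebraicGeometry.Frobenioids
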